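import Summits.ValiantsHypothesis.ValiantsHypothesis.Theorems.DepthWindowSumProdIter
import Summits.ValiantsHypothesis.ValiantsHypothesis.Theorems.DepthWindowIMMPaths
import HarnessLib

/-!
# Route `DepthWindow`, g8 — the generic `Σ Π Σ Π` gate builder

Gate-level piece (iii) of the `(2,3)` SLIVER LEMMA (lens-4 NODE-v8 §10), assembled from
`Theorems/DepthWindowSumProdLayer.lean` (one `Σ Π` step) and `Theorems/DepthWindowSumProdIter.lean`
(its iteration): `exists_append_sumProdSumProd` appends to a gate list `Ψ₀` a realisation of

`Σ_{α<nA} cA α · ∏_{q<a} Σ_{β<nB} cB α q β · ∏_{u<b} leaf α q β u`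

whose leaves are operands referencing `Ψ₀` — `nA·a` inner blocks (product layer of fan-in `b` +
collecting sum gate) followed by one outer block (product layer of fan-in `a` over the inner sum
gates + the output sum gate): `nA·a·(nB+1) + nA + 1` new gates, every new `prodWeight`-depth entry
at most `D₀ + 2` (two product levels above leaves of depth `≤ D₀`), and every new value weighted
homogeneous provided block `(α, q)`'s leaf products all have weight `wt α q` with `Σ_q wt α q = E`.
FUSION with a product layer below (`ΠΠ = Π`, NODE-v7 §6 (4)) needs no extra lemma: the caller passes
the concatenated operand families as `leaf` (inner fan-in `b·F`).  Applied to the fixed-endpoint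
two-level jump formula (`weightedHomogeneousComponent_prod_eq_twoLevel_fix`, after `Fintype.equivFin`
re-indexing) this is the homogeneous product-depth-`(base+2)` realisation of `[∏ U_l]_e`.
Generic bookkeeping over a commutative semiring; nothing here bears on `VP ≠ VNP`.

[cite: Burgisser2000, Def. 2.1] [cite: LimayeSrinivasanTavenas2025, Lemma 11]
-/

set_option linter.dupNamespace false

namespace Summit.ValiantsHypothesis.ValiantsHypothesis.Theorems.DepthWindow

open MvPolynomial Literature.Computability.AlgebraicComplexity ArithCircuit Finset
open Literature.Computability.AlgebraicComplexity.DepthReduction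

variable {k : Type*} [CommSemiring k] {τ : Type*}

/-! ### Decoding the inner block index `i = α·a + q` -/

/-- `(α·a + q) / a = α` for `q < a`. -/
theorem blockIdx_div (a α q : ℕ) (hq : q < a) : (α * a + q) / a = α := by
  rw [Nat.add_comm, Nat.add_mul_div_right _ _ (by omega), Nat.div_eq_of_lt hq, Nat.zero_add]

/-- `(α·a + q) % a = q` for `q < a`. -/
theorem blockIdx_mod (a α q : ℕ) (hq : q < a) : (α * a + q) % a = q := by
  rw [Nat.add_comm, Nat.add_mul_mod_self_right, Nat.mod_eq_of_lt hq]

/-- The quotient of an inner block index is a valid outer index. -/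
theorem blockIdx_div_lt {nA a i : ℕ} (h : i < nA * a) : i / a < nA :=
  Nat.div_lt_of_lt_mul (by rwa [Nat.mul_comm] at h)

/-- The remainder of an inner block index is a valid position in the block. -/
theorem blockIdx_mod_lt {nA a i : ℕ} (h : i < nA * a) : i % a < a :=
  Nat.mod_lt _ (Nat.pos_of_ne_zero (by rintro rfl; simp at h))

/-- `ℕ`-indexed extension (junk outside the range) of a table indexed by `Fin nA × Fin a`. -/
def blockExt {nA a : ℕ} {β : Type*} (F : Fin nA → Fin a → β) (dflt : β) (i : ℕ) : β :=
  if h : i < nA * a then F ⟨i / a, blockIdx_div_lt h⟩ ⟨i % a, blockIdx_mod_lt h⟩ else dflt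

/-- `blockExt` at the block index `α·a + q`. -/
theorem blockExt_block {nA a : ℕ} {β : Type*} (F : Fin nA → Fin a → β) (dflt : β) (α : Fin nA)
    (q : Fin a) : blockExt F dflt ((α : ℕ) * a + q) = F α q := by
  unfold blockExt
  rw [dif_pos (blockIndex_lt α q)]
  congr 1
  · exact Fin.ext (blockIdx_div a α q q.isLt)
  · exact Fin.ext (blockIdx_mod a α q q.isLt)

/-- Every `i < nA·a` is a block index. -/
theorem exists_block_of_lt {nA a i : ℕ} (h : i < nA * a) :
    ∃ (α : Fin nA) (q : Fin a), i = (α : ℕ) * a + q :=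
  ⟨⟨i / a, blockIdx_div_lt h⟩, ⟨i % a, blockIdx_mod_lt h⟩, by
    simp only
    have := Nat.div_add_mod i a
    rw [Nat.mul_comm]; omega⟩

/-! ### The two-level builder -/

/-- **Generic `Σ Π Σ Π` realisation** two product levels above its leaves (module docstring).
[cite: Burgisser2000, Def. 2.1] [cite: LimayeSrinivasanTavenas2025, Lemma 11] -/
theorem exists_append_sumProdSumProd (w : τ → ℕ) {nA nB a b : ℕ} (Ψ₀ : List (Gate k τ))
    (cA : Fin nA → k) (cB : Fin nA → Fin a → Fin nB → k)
    (leaf : Fin nA → Fin a → Fin nB → Fin b → Operand k τ) (D₀ E : ℕ) (wt : Fin nA → Fin a → ℕ)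
    (hrefs : ∀ α q β u, (leaf α q β u).RefsBelow Ψ₀.length)
    (hdepth : ∀ α q β u, (leaf α q β u).depthIn (gateWDepths prodWeight Ψ₀) ≤ D₀)
    (hhom₀ : ∀ g ∈ gateValues Ψ₀, ∃ e : ℕ, IsWeightedHomogeneous w g e)
    (hwt : ∀ α q β, IsWeightedHomogeneous w
      (∏ u : Fin b, (leaf α q β u).eval (gateValues Ψ₀)) (wt α q))
    (hE : ∀ α, ∑ q : Fin a, wt α q = E) :
    ∃ (Δ : List (Gate k τ)) (o : Operand k τ),
      Δ.length = nA * a * (nB + 1) + (nA + 1) ∧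
      (∀ vs : List (Operand k τ), Gate.prod vs ∈ Δ → vs.length = b ∨ vs.length = a) ∧
      (∀ g ∈ gateValues (Ψ₀ ++ Δ), ∃ e : ℕ, IsWeightedHomogeneous w g e) ∧
      (∀ x ∈ gateWDepths prodWeight (Ψ₀ ++ Δ), x ∈ gateWDepths prodWeight Ψ₀ ∨ x ≤ D₀ + 2) ∧
      o.RefsBelow (Ψ₀ ++ Δ).length ∧
      o.depthIn (gateWDepths prodWeight (Ψ₀ ++ Δ)) ≤ D₀ + 2 ∧
      IsWeightedHomogeneous w (o.eval (gateValues (Ψ₀ ++ Δ))) E ∧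
      o.eval (gateValues (Ψ₀ ++ Δ)) =
        ∑ α : Fin nA, C (cA α) * ∏ q : Fin a, ∑ β : Fin nB, C (cB α q β) *
          ∏ u : Fin b, (leaf α q β u).eval (gateValues Ψ₀) := by
  -- ℕ-indexed inner data
  set cI : ℕ → Fin nB → k := blockExt cB (fun _ => 0) with hcI
  set oI : ℕ → Fin nB → Fin b → Operand k τ := blockExt leaf (fun _ _ => Operand.const 0) with hoI
  set W : ℕ → ℕ := blockExt wt 0 with hWdef
  have hcI_b : ∀ (α : Fin nA) (q : Fin a), cI ((α : ℕ) * a + q) = cB α q := fun α q => by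
    rw [hcI, blockExt_block]
  have hoI_b : ∀ (α : Fin nA) (q : Fin a), oI ((α : ℕ) * a + q) = leaf α q := fun α q => by
    rw [hoI, blockExt_block]
  have hW_b : ∀ (α : Fin nA) (q : Fin a), W ((α : ℕ) * a + q) = wt α q := fun α q => by
    rw [hWdef, blockExt_block]
  -- the inner blocks
  have hrefsI : ∀ i < nA * a, ∀ j u, (oI i j u).RefsBelow Ψ₀.length := by
    intro i hi j u
    obtain ⟨α, q, rfl⟩ := exists_block_of_lt hi
    rw [hoI_b]; exact hrefs α q j u
  have hdpI : ∀ i < nA * a, ∀ j u, (oI i j u).depthIn (gateWDepths prodWeight Ψ₀) ≤ D₀ := by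
    intro i hi j u
    obtain ⟨α, q, rfl⟩ := exists_block_of_lt hi
    rw [hoI_b]; exact hdepth α q j u
  have hWI : ∀ i < nA * a, ∀ j, IsWeightedHomogeneous w
      (∏ u : Fin b, (oI i j u).eval (gateValues Ψ₀)) (W i) := by
    intro i hi j
    obtain ⟨α, q, rfl⟩ := exists_block_of_lt hi
    rw [hoI_b, hW_b]; exact hwt α q j
  obtain ⟨hhom₁, hdep₁, hout₁⟩ :=
    sumProdDelta_spec w cI oI Ψ₀ (nA * a) D₀ W hrefsI hdpI hhom₀ hWI (nA * a) le_rfl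
  set Ψ₁ := Ψ₀ ++ sumProdDelta cI oI Ψ₀.length (nA * a) with hΨ₁
  have hlen₁ : Ψ₁.length = Ψ₀.length + nA * a * (nB + 1) := by
    rw [hΨ₁, List.length_append, length_sumProdDelta]
  -- the outer block: products over the inner sum gates, then the output sum
  set oO : Fin nA → Fin a → Operand k τ := fun α q =>
    Operand.gate (sumProdPos Ψ₀.length nB ((α : ℕ) * a + q)) with hoO
  have hposO : ∀ (α : Fin nA) (q : Fin a),
      sumProdPos Ψ₀.length nB ((α : ℕ) * a + q) < Ψ₁.length := fun α q =>
    (hout₁ _ (blockIndex_lt α q)).1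
  have hvalO : ∀ (α : Fin nA) (q : Fin a), (oO α q).eval (gateValues Ψ₁) =
      ∑ β : Fin nB, C (cB α q β) * ∏ u : Fin b, (leaf α q β u).eval (gateValues Ψ₀) := by
    intro α q
    show (gateValues Ψ₁).getD _ 0 = _
    rw [(hout₁ _ (blockIndex_lt α q)).2.1, hcI_b, hoI_b]
  have hhomO : ∀ (α : Fin nA) (q : Fin a),
      IsWeightedHomogeneous w ((oO α q).eval (gateValues Ψ₁)) (wt α q) := by
    intro α q
    show IsWeightedHomogeneous w ((gateValues Ψ₁).getD _ 0) _
    rw [← hW_b α q]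
    exact (hout₁ _ (blockIndex_lt α q)).2.2.1
  have hstep := sumProd_step w cA oO Ψ₁ (D₀ + 1) E
    (fun α q => hposO α q)
    (fun α q => (hout₁ _ (blockIndex_lt α q)).2.2.2)
    hhom₁
    (fun α => by
      have := IsWeightedHomogeneous.prod Finset.univ (fun q : Fin a => (oO α q).eval (gateValues Ψ₁))
        (fun q => wt α q) (fun q _ => hhomO α q)
      rwa [hE α] at this)
  obtain ⟨hL, hfan, hhomS, hdepS, hvalS, hhomvS, hdS⟩ := hstep
  refine ⟨sumProdDelta cI oI Ψ₀.length (nA * a) ++ (prodLayer oO ++ [sumGate cA Ψ₁.length]),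
    Operand.gate (Ψ₁.length + nA), ?_, ?_, ?_⟩
  · rw [List.length_append, length_sumProdDelta, List.length_append, length_prodLayer,
      List.length_singleton]
  · intro vs hvs
    rw [List.mem_append] at hvs
    rcases hvs with h | h
    · exact Or.inl (fanIn_sumProdDelta cI oI _ _ vs h)
    · exact Or.inr (hfan vs h)
  have hshape : Ψ₀ ++ (sumProdDelta cI oI Ψ₀.length (nA * a) ++
      (prodLayer oO ++ [sumGate cA Ψ₁.length])) = Ψ₁ ++ prodLayer oO ++ [sumGate cA Ψ₁.length] := by
    rw [hΨ₁, List.append_assoc, List.append_assoc]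
  rw [hshape]
  refine ⟨hhomS, ?_, ?_, ?_, ?_, ?_⟩
  · intro x hx
    rcases hdepS x hx with hx' | hx'
    · rcases hdep₁ x hx' with hx'' | hx''
      · exact Or.inl hx''
      · exact Or.inr (by omega)
    · exact Or.inr hx'
  · show Ψ₁.length + nA < _
    rw [hL]; omega
  · show (gateWDepths prodWeight _).getD _ 0 ≤ _
    exact hdS
  · show IsWeightedHomogeneous w ((gateValues _).getD _ 0) _
    exact hhomvS
  · show (gateValues _).getD _ 0 = _
    rw [hvalS]
    refine Finset.sum_congr rfl fun α _ => ?_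
    congr 1
    exact Finset.prod_congr rfl fun q _ => hvalO α q

end Summit.ValiantsHypothesis.ValiantsHypothesis.Theorems.DepthWindow
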